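import Summits.QuantumFields.BalabanUV.T4Continuum.Support.NE3SmoothLiftFlat
import Summits.QuantumFields.BalabanUV.T4Continuum.Support.SmoothRefineInterp
import HarnessLib

/-!
# NE7InterpolationLiftFlat — THE INTERPOLATION LIFT OF A COARSE BOND FIELD (row NE3's signed longitudinal profile × the transverse MULTILINEAR INTERPOLANT of the datum)
# and its straight-line block average: `linQ_M (ilift φ) (M•y) κ = Σ_{T ⊆ {j ≠ κ}} w_T • φ (y + 𝟙_T) κ`, `w_T = M^{1−d}·((M−1)∕2)^{|T|}·((M+1)∕2)^{d−1−|T|} ≥ 0`, `Σ_T w_T = 1`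

Lineage `b2b-balaban-t4-ne7b-p1` (row NE7b OWNER; junction service for row NE7), generation 160; item (U) of the road's memo `t4/b2b-balaban-t4-ne7-p1-g116/ROAD-G116.md` §6, the
HOMOGENEOUS half («uniform upper bound via a MULTILINEAR-INTERPOLATION right inverse of `levelQ′`»: a lift whose curl is controlled by the coarse GRADIENT of the datum, not by its mass).
Row NE3's smooth lift ✓ `NE3SmoothLiftFlat.smoothLift` multiplies the block's OWN datum by an in-block bump, so a constant datum is lifted to a field with curl `O(φ∕M²)` (its letter
✓ `NE3SmoothLiftCurl.curlSq_flat_smoothLift_le` is `M^{d−4}·‖φ‖²`, NO `∇φ`).  THIS FILE replaces the transverse bump by the transverse MULTILINEAR INTERPOLANT of the datum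
(✓ `SmoothRefineInterp.interp M (univ.erase κ) (φ(·,κ))`, whose unit-step differences are `(1∕M) •` interpolants of the coarse forward differences, ✓ `interp_fd`), keeping row NE3's
signed longitudinal profile ✓ `NE3SmoothLiftProfile.lprof` (whose near∕far line weights are (E2) `Σ_t (t+1)·lprof t = (M−1)(M+1)(M+2)∕12` and (E1) `Σ_t (M−1−t)·lprof t = 0`):
  `ilift M φ (z, κ) := (12M∕((M−1)(M+1)(M+2))·lprof M (res_κ z)) • interp M (univ ∖ {κ}) (φ(·, κ)) z`   (written out in every statement; no `def`).
WHAT ([folklore]; 0 def, 0 sorry): §1 `sum_fin_div_eq`, `sum_fin_one_sub_div_eq` (`Σ_{t<M} t∕M = (M−1)∕2`, `Σ_{t<M} (1 − t∕M) = (M+1)∕2`); §2 `interp_line` (on a κ-line the transverse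
interpolant reads the block `y` before the crossing and `y + e_κ` after it, with the SAME transverse weights `r_j∕M`); §3 **`sum_boxVec_mul_interpCore`** (the block sum of
`g(r_κ) • interpCore` factorises: `Σ_r g(r_κ) • I(r) = Σ_T (Σ_t g t)·((M−1)∕2)^{|T|}·((M+1)∕2)^{|S∖T|} • φ(z + 𝟙_T)`); §4 **`linQ_interpLift`** (the display above);
§5 `interpWeight_nonneg`, **`sum_interpWeight`** (`= 1`, binomial theorem).  So the straight average of the interpolation lift is a forward CONVEX STENCIL of the datum, and the defect
`φ − σφ = Σ_T w_T • (φ(y) − φ(y + 𝟙_T))` is a combination of coarse GRADIENTS (next files: the defect is lifted by row NE3's `smoothLift`, the sum has curl `O(∇φ∕M²)`).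
HONEST FRAMING: flat lattice kinematics of OUR lift; nothing of Bałaban's asserted ([Balaban1984PropagatorsI] (1.20)–(1.21) context only); NOT NE7∕NE3 as spine nodes; row NE7b NOT
touched; spine 0∕9; finite T⁴ rung (B)+1 — NOT infinite volume, NOT mass gap, NOT BetaPertH, NOT Clay.
-/

set_option autoImplicit false

open scoped BigOperators Matrix.Norms.L2Operator
open Finset

namespace Summit.QuantumFields.BalabanUV.T4Continuum.NE7InterpolationLiftFlat

open Literature.MathematicalPhysics.QuantumFieldTheory.Balaban1983to89
open B7Prop1Explicit B7Prop2Explicit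
open B7Prop3Flat (linQ)
open B7Prop4Flat (linQ_eq_sum)
open SmoothRefineBlocks (blk res)
open SmoothRefineInterp (interp interpCore indic interpCore_congr_weights)
open NE3SmoothLiftProfile (lprof sum_far_weight_lprof sum_near_weight_lprof)
open NE3SmoothLiftFlat (blk_res_line_lt blk_res_line_ge sum_sum_ite_lt sum_sum_ite_ge)

noncomputable section

variable {d : ℕ} {n : Type*} [Fintype n] [DecidableEq n]

/-! ## §1 Two block sums of the interpolation weights -/

omit [Fintype n] [DecidableEq n] in
/-- `Σ_{t<M} t∕M = (M−1)∕2` (`M ≥ 1`). [folklore] -/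
theorem sum_fin_div_eq {M : ℕ} (hM : 1 ≤ M) : ∑ t : Fin M, ((t : ℕ) : ℝ) / M = (((M : ℝ)) - 1) / 2 := by
  have hM0 : (M : ℝ) ≠ 0 := by exact_mod_cast (by omega : M ≠ 0)
  rw [Fin.sum_univ_eq_sum_range (fun t => (t : ℝ) / M) M, ← Finset.sum_div]
  have h := Finset.sum_range_id_mul_two M
  have h' : (∑ i ∈ Finset.range M, (i : ℝ)) * 2 = (M : ℝ) * ((M : ℝ) - 1) := by
    have := congrArg (fun k : ℕ => (k : ℝ)) h
    push_cast [Nat.cast_sub hM] at this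
    exact_mod_cast this
  field_simp
  linarith

omit [Fintype n] [DecidableEq n] in
/-- `Σ_{t<M} (1 − t∕M) = (M+1)∕2` (`M ≥ 1`). [folklore] -/
theorem sum_fin_one_sub_div_eq {M : ℕ} (hM : 1 ≤ M) : ∑ t : Fin M, (1 - ((t : ℕ) : ℝ) / M) = (((M : ℝ)) + 1) / 2 := by
  rw [Finset.sum_sub_distrib, sum_fin_div_eq hM, Finset.sum_const, Finset.card_univ, Fintype.card_fin, nsmul_eq_mul, mul_one]
  ring

/-! ## §2 The transverse interpolant on a κ-line -/

omit [Fintype n] [DecidableEq n] in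
/-- **ON A κ-LINE THE TRANSVERSE INTERPOLANT READS THE BLOCK `y` BEFORE THE CROSSING AND `y + e_κ` AFTER IT, WITH THE SAME TRANSVERSE WEIGHTS `r_j∕M`** (`κ ∉ S`, `i < M`). [folklore] -/
theorem interp_line {X : Type*} [AddCommGroup X] [Module ℝ X] {M : ℕ} (hM : 1 ≤ M) {S : Finset (Fin d)} {κ : Fin d} (hκ : κ ∉ S) (G : Site d → X)
    (y : Site d) (r : Fin d → Fin M) {i : ℕ} (hi : i < M) :
    interp M S G ((M : ℤ) • y + boxVec M r + (i : ℤ) • e κ)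
      = interpCore S G (if (r κ : ℕ) + i < M then y else y + e κ) (fun j => ((r j : ℕ) : ℝ) / M) := by
  unfold interp
  by_cases h : (r κ : ℕ) + i < M
  · obtain ⟨hb, hr⟩ := blk_res_line_lt hM y r i κ h
    rw [if_pos h, hb]
    refine interpCore_congr_weights S G y fun j hj => ?_
    have hne : j ≠ κ := fun hjκ => hκ (hjκ ▸ hj)
    show (res M ((M : ℤ) • y + boxVec M r + (i : ℤ) • e κ) j : ℝ) / M = ((r j : ℕ) : ℝ) / M
    rw [hr]
    simp [boxVec, e_apply, hne]
  · obtain ⟨hb, hr⟩ := blk_res_line_ge hM y r i hi κ (not_lt.mp h)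
    rw [if_neg h, hb]
    refine interpCore_congr_weights S G (y + e κ) fun j hj => ?_
    have hne : j ≠ κ := fun hjκ => hκ (hjκ ▸ hj)
    show (res M ((M : ℤ) • y + boxVec M r + (i : ℤ) • e κ) j : ℝ) / M = ((r j : ℕ) : ℝ) / M
    rw [hr]
    simp [boxVec, e_apply, hne]

omit [Fintype n] [DecidableEq n] in
/-- The longitudinal offset on a κ-line, near part: `res_κ = r_κ + i`. [folklore] -/
theorem res_line_lt {M : ℕ} (hM : 1 ≤ M) (y : Site d) (r : Fin d → Fin M) {i : ℕ} (κ : Fin d) (h : (r κ : ℕ) + i < M) :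
    res M ((M : ℤ) • y + boxVec M r + (i : ℤ) • e κ) κ = (((r κ : ℕ) + i : ℕ) : ℤ) := by
  rw [(blk_res_line_lt hM y r i κ h).2]
  simp [boxVec, e_apply]

omit [Fintype n] [DecidableEq n] in
/-- The longitudinal offset on a κ-line, far part: `res_κ = r_κ + i − M`. [folklore] -/
theorem res_line_ge {M : ℕ} (hM : 1 ≤ M) (y : Site d) (r : Fin d → Fin M) {i : ℕ} (hi : i < M) (κ : Fin d) (h : M ≤ (r κ : ℕ) + i) :
    res M ((M : ℤ) • y + boxVec M r + (i : ℤ) • e κ) κ = (((r κ : ℕ) + i - M : ℕ) : ℤ) := by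
  rw [(blk_res_line_ge hM y r i hi κ h).2]
  simp only [Pi.add_apply, Pi.sub_apply, boxVec, Pi.smul_apply, e_apply, smul_eq_mul, if_true]
  push_cast [Nat.cast_sub h]
  ring

/-! ## §3 The block sum of `g(r_κ) • interpCore` factorises -/

omit [Fintype n] [DecidableEq n] in
/-- **TRANSVERSE FACTORISATION WITH THE INTERPOLANT** (`S = univ ∖ {κ}`): `Σ_{r ∈ [0,M)^d} g(r_κ) • interpCore S G z (r∕M) = Σ_{T ⊆ S} ((Σ_t g t)·((M−1)∕2)^{|T|}·((M+1)∕2)^{|S|−|T|}) • G (z + 𝟙_T)`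
(`M ≥ 1`; Fubini for product-form sums, `Σ_t t∕M = (M−1)∕2`, `Σ_t (1 − t∕M) = (M+1)∕2`). [folklore] -/
theorem sum_boxVec_mul_interpCore {X : Type*} [AddCommGroup X] [Module ℝ X] {M : ℕ} (hM : 1 ≤ M) (κ : Fin d) (g : Fin M → ℝ) (G : Site d → X) (z : Site d) :
    ∑ r : Fin d → Fin M, g (r κ) • interpCore (Finset.univ.erase κ) G z (fun j => ((r j : ℕ) : ℝ) / M)
      = ∑ T ∈ (Finset.univ.erase κ).powerset,
          ((∑ t : Fin M, g t) * ((((M : ℝ)) - 1) / 2) ^ T.card * ((((M : ℝ)) + 1) / 2) ^ ((Finset.univ.erase κ).card - T.card)) • G (z + indic T) := by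
  set S : Finset (Fin d) := Finset.univ.erase κ with hS
  -- expand the core and swap the sums
  have hexp : ∀ r : Fin d → Fin M, g (r κ) • interpCore S G z (fun j => ((r j : ℕ) : ℝ) / M)
      = ∑ T ∈ S.powerset, (g (r κ) * ((∏ i ∈ T, ((r i : ℕ) : ℝ) / M) * ∏ i ∈ S \ T, (1 - ((r i : ℕ) : ℝ) / M))) • G (z + indic T) := by
    intro r
    unfold interpCore
    rw [Finset.smul_sum]
    refine Finset.sum_congr rfl fun T _ => ?_
    rw [smul_smul]
  rw [Finset.sum_congr rfl fun r _ => hexp r, Finset.sum_comm]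
  refine Finset.sum_congr rfl fun T hT => ?_
  rw [← Finset.sum_smul]
  congr 1
  rw [Finset.mem_powerset] at hT
  -- the product form: `h j t = g t` for `j = κ`, `t/M` on `T`, `1 − t/M` on `S \ T`
  let h : Fin d → Fin M → ℝ := fun j t => if j = κ then g t else if j ∈ T then ((t : ℕ) : ℝ) / M else 1 - ((t : ℕ) : ℝ) / M
  have hκT : κ ∉ T := fun hk => by have := hT hk; simp [hS] at this
  have hterm : ∀ r : Fin d → Fin M,
      g (r κ) * ((∏ i ∈ T, ((r i : ℕ) : ℝ) / M) * ∏ i ∈ S \ T, (1 - ((r i : ℕ) : ℝ) / M)) = ∏ j : Fin d, h j (r j) := by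
    intro r
    rw [← Finset.mul_prod_erase Finset.univ (fun j => h j (r j)) (Finset.mem_univ κ), ← hS]
    have hsplit : ∏ j ∈ S, h j (r j) = (∏ i ∈ T, h i (r i)) * ∏ i ∈ S \ T, h i (r i) := by
      rw [← Finset.prod_union (Finset.disjoint_sdiff), Finset.union_sdiff_of_subset hT]
    rw [hsplit]
    congr 1
    · simp [h]
    · congr 1
      · exact Finset.prod_congr rfl fun i hi => by
          have hiκ : i ≠ κ := fun hh => hκT (hh ▸ hi)
          simp [h, hiκ, hi]
      · exact Finset.prod_congr rfl fun i hi => by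
          have hiS : i ∈ S := (Finset.mem_sdiff.1 hi).1
          have hiT : i ∉ T := (Finset.mem_sdiff.1 hi).2
          have hiκ : i ≠ κ := Finset.ne_of_mem_erase hiS
          simp [h, hiκ, hiT]
  rw [Finset.sum_congr rfl fun r _ => hterm r, ← Fintype.piFinset_univ,
    ← Finset.prod_univ_sum (fun _ : Fin d => (Finset.univ : Finset (Fin M))) h,
    ← Finset.mul_prod_erase _ _ (Finset.mem_univ κ), ← hS]
  have hsplit : ∏ j ∈ S, ∑ t : Fin M, h j t = (∏ i ∈ T, ∑ t : Fin M, h i t) * ∏ i ∈ S \ T, ∑ t : Fin M, h i t := by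
    rw [← Finset.prod_union (Finset.disjoint_sdiff), Finset.union_sdiff_of_subset hT]
  rw [hsplit, mul_assoc]
  congr 1
  · simp [h]
  · rw [← Finset.card_sdiff_of_subset hT]
    congr 1
    · rw [Finset.prod_congr rfl fun i hi => show ∑ t : Fin M, h i t = (((M : ℝ)) - 1) / 2 from by
          have hiκ : i ≠ κ := fun hh => hκT (hh ▸ hi)
          simp only [h, hiκ, hi, if_true, if_false]
          exact sum_fin_div_eq hM,
        Finset.prod_const]
    · rw [Finset.prod_congr rfl fun i hi => show ∑ t : Fin M, h i t = (((M : ℝ)) + 1) / 2 from by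
          have hiS : i ∈ S := (Finset.mem_sdiff.1 hi).1
          have hiT : i ∉ T := (Finset.mem_sdiff.1 hi).2
          have hiκ : i ≠ κ := Finset.ne_of_mem_erase hiS
          simp only [h, hiκ, hiT, if_false]
          exact sum_fin_one_sub_div_eq hM,
        Finset.prod_const]

/-! ## §4 The straight-line block average of the interpolation lift -/

/-- **THE STRAIGHT-LINE BLOCK AVERAGE OF THE INTERPOLATION LIFT IS A FORWARD CONVEX STENCIL OF THE DATUM** (`M ≥ 2`):
`linQ M (ilift M φ) (M•y) κ = Σ_{T ⊆ univ ∖ {κ}} (M^{−(d−1)}·((M−1)∕2)^{|T|}·((M+1)∕2)^{(d−1)−|T|}) • φ (y + 𝟙_T) κ`, where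
`ilift M φ (z, κ) = (12M∕((M−1)(M+1)(M+2))·lprof M (res_κ z)) • interp M (univ ∖ {κ}) (φ(·,κ)) z`. [folklore] -/
theorem linQ_interpLift {M : ℕ} (hM : 2 ≤ M) (φ : Site d → Fin d → Matrix n n ℂ) (y : Site d) (κ : Fin d) :
    linQ M (fun z κ' => ((12 * (M : ℝ) / ((((M : ℝ)) - 1) * ((M : ℝ) + 1) * ((M : ℝ) + 2))) * lprof M (res M z κ'))
        • interp M (Finset.univ.erase κ') (fun w => φ w κ') z) ((M : ℤ) • y) κ
      = ∑ T ∈ (Finset.univ.erase κ).powerset,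
          ((((M : ℝ)) ^ (d - 1))⁻¹ * ((((M : ℝ)) - 1) / 2) ^ T.card * ((((M : ℝ)) + 1) / 2) ^ ((d - 1) - T.card)) • φ (y + indic T) κ := by
  have hM1 : 1 ≤ M := by omega
  have hM0 : (M : ℝ) ≠ 0 := by exact_mod_cast (by omega : M ≠ 0)
  set a : ℝ := 12 * (M : ℝ) / ((((M : ℝ)) - 1) * ((M : ℝ) + 1) * ((M : ℝ) + 2)) with ha
  set S : Finset (Fin d) := Finset.univ.erase κ with hS
  have hκS : κ ∉ S := by simp [hS]
  set G : Site d → Matrix n n ℂ := fun w => φ w κ with hG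
  -- the near and far longitudinal weights of a start offset `r_κ`
  let A : ℕ → ℝ := fun ρ => ∑ i ∈ Finset.range M, (if ρ + i < M then lprof M ((ρ + i : ℕ) : ℤ) else 0)
  let B : ℕ → ℝ := fun ρ => ∑ i ∈ Finset.range M, (if ρ + i < M then 0 else lprof M ((ρ + i - M : ℕ) : ℤ))
  -- (1) each line
  have hline : ∀ r : Fin d → Fin M, ∑ i : Fin M,
      (fun z κ' => (a * lprof M (res M z κ')) • interp M (Finset.univ.erase κ') (fun w => φ w κ') z) ((M : ℤ) • y + boxVec M r + ((i : ℕ) : ℤ) • e κ) κ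
      = (a * A (r κ)) • interpCore S G y (fun j => ((r j : ℕ) : ℝ) / M)
        + (a * B (r κ)) • interpCore S G (y + e κ) (fun j => ((r j : ℕ) : ℝ) / M) := by
    intro r
    have hsum : ∀ i : Fin M,
        (fun z κ' => (a * lprof M (res M z κ')) • interp M (Finset.univ.erase κ') (fun w => φ w κ') z) ((M : ℤ) • y + boxVec M r + ((i : ℕ) : ℤ) • e κ) κ
        = (a * (if (r κ : ℕ) + i < M then lprof M (((r κ : ℕ) + i : ℕ) : ℤ) else 0)) • interpCore S G y (fun j => ((r j : ℕ) : ℝ) / M)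
          + (a * (if (r κ : ℕ) + i < M then 0 else lprof M (((r κ : ℕ) + i - M : ℕ) : ℤ))) • interpCore S G (y + e κ) (fun j => ((r j : ℕ) : ℝ) / M) := by
      intro i
      show (a * lprof M (res M ((M : ℤ) • y + boxVec M r + ((i : ℕ) : ℤ) • e κ) κ)) • interp M S G ((M : ℤ) • y + boxVec M r + ((i : ℕ) : ℤ) • e κ) = _
      rw [interp_line hM1 hκS G y r i.isLt]
      by_cases h : (r κ : ℕ) + i < M
      · rw [res_line_lt hM1 y r κ h, if_pos h, if_pos h, if_pos h, mul_zero, zero_smul, add_zero]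
      · rw [res_line_ge hM1 y r i.isLt κ (not_lt.mp h), if_neg h, if_neg h, if_neg h, mul_zero, zero_smul, zero_add]
    rw [Finset.sum_congr rfl fun i _ => hsum i, Finset.sum_add_distrib, ← Finset.sum_smul, ← Finset.sum_smul, ← Finset.mul_sum, ← Finset.mul_sum]
    simp only [A, B, Fin.sum_univ_eq_sum_range (fun i => if (r κ : ℕ) + i < M then lprof M (((r κ : ℕ) + i : ℕ) : ℤ) else 0) M,
      Fin.sum_univ_eq_sum_range (fun i => if (r κ : ℕ) + i < M then (0 : ℝ) else lprof M (((r κ : ℕ) + i - M : ℕ) : ℤ)) M]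
  -- (2) the longitudinal sums: (E2) and (E1)
  have hA : ∑ t : Fin M, A t = (((M : ℝ)) - 1) * ((M : ℝ) + 1) * ((M : ℝ) + 2) / 12 := by
    rw [Fin.sum_univ_eq_sum_range (fun t => A t) M]
    simp only [A]
    rw [sum_sum_ite_lt M (fun t => lprof M (t : ℤ)), ← Fin.sum_univ_eq_sum_range (fun t => ((t : ℝ) + 1) * lprof M (t : ℤ)) M, sum_near_weight_lprof M hM1]
  have hB : ∑ t : Fin M, B t = 0 := by
    rw [Fin.sum_univ_eq_sum_range (fun t => B t) M]
    simp only [B]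
    rw [sum_sum_ite_ge M (fun t => lprof M (t : ℤ)), ← Fin.sum_univ_eq_sum_range (fun t => (((M : ℝ)) - 1 - (t : ℝ)) * lprof M (t : ℤ)) M,
      sum_far_weight_lprof M hM1]
  -- (3) assemble
  rw [linQ_eq_sum]
  calc ∑ r : Fin d → Fin M, (((M : ℝ) ^ d)⁻¹ : ℝ) • ∑ i : Fin M,
        (fun z κ' => (a * lprof M (res M z κ')) • interp M (Finset.univ.erase κ') (fun w => φ w κ') z) ((M : ℤ) • y + boxVec M r + ((i : ℕ) : ℤ) • e κ) κ
      = (((M : ℝ) ^ d)⁻¹ * a) • ((∑ r : Fin d → Fin M, A (r κ) • interpCore S G y (fun j => ((r j : ℕ) : ℝ) / M))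
          + ∑ r : Fin d → Fin M, B (r κ) • interpCore S G (y + e κ) (fun j => ((r j : ℕ) : ℝ) / M)) := by
        rw [smul_add, Finset.smul_sum, Finset.smul_sum, ← Finset.sum_add_distrib]
        refine Finset.sum_congr rfl fun r _ => ?_
        rw [hline r, smul_add, smul_smul, smul_smul, smul_smul, smul_smul]
        congr 1 <;> congr 1 <;> ring
    _ = (((M : ℝ) ^ d)⁻¹ * a) • ((∑ T ∈ S.powerset, ((∑ t : Fin M, A t) * ((((M : ℝ)) - 1) / 2) ^ T.card * ((((M : ℝ)) + 1) / 2) ^ (S.card - T.card)) • G (y + indic T))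
          + ∑ T ∈ S.powerset, ((∑ t : Fin M, B t) * ((((M : ℝ)) - 1) / 2) ^ T.card * ((((M : ℝ)) + 1) / 2) ^ (S.card - T.card)) • G (y + e κ + indic T)) := by
        rw [hS, sum_boxVec_mul_interpCore hM1 κ (fun t => A t) G y, sum_boxVec_mul_interpCore hM1 κ (fun t => B t) G (y + e κ)]
    _ = ∑ T ∈ S.powerset, ((((M : ℝ)) ^ (d - 1))⁻¹ * ((((M : ℝ)) - 1) / 2) ^ T.card * ((((M : ℝ)) + 1) / 2) ^ ((d - 1) - T.card)) • φ (y + indic T) κ := by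
        rw [hA, hB]
        simp only [zero_mul, zero_smul, Finset.sum_const_zero, add_zero, Finset.smul_sum, smul_smul]
        refine Finset.sum_congr rfl fun T _ => ?_
        have hScard : S.card = d - 1 := by rw [hS, Finset.card_erase_of_mem (Finset.mem_univ κ), Finset.card_univ, Fintype.card_fin]
        rw [hScard]
        congr 1
        have hM2 : (2 : ℝ) ≤ M := by exact_mod_cast hM
        have h1 : ((M : ℝ)) - 1 ≠ 0 := by linarith
        have hE : (((M : ℝ)) - 1) * ((M : ℝ) + 1) * ((M : ℝ) + 2) ≠ 0 := by positivity
        have hd1 : (M : ℝ) ^ d = (M : ℝ) ^ (d - 1) * M := by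
          cases d with
          | zero => exact absurd κ.isLt (by omega)
          | succ k => rw [Nat.succ_sub_one, pow_succ]
        rw [ha, hd1]
        field_simp

/-! ## §5 The stencil weights: non-negative, summing to one -/

omit [Fintype n] [DecidableEq n] in
/-- The stencil weights are non-negative (`M ≥ 1`). [folklore] -/
theorem interpWeight_nonneg {M : ℕ} (hM : 1 ≤ M) (T : Finset (Fin d)) :
    0 ≤ (((M : ℝ)) ^ (d - 1))⁻¹ * ((((M : ℝ)) - 1) / 2) ^ T.card * ((((M : ℝ)) + 1) / 2) ^ ((d - 1) - T.card) := by
  have hM1 : (1 : ℝ) ≤ M := by exact_mod_cast hM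
  have h0 : (0 : ℝ) ≤ ((M : ℝ)) - 1 := by linarith
  positivity

omit [Fintype n] [DecidableEq n] in
/-- **THE STENCIL WEIGHTS SUM TO ONE**: `Σ_{T ⊆ univ ∖ {κ}} M^{−(d−1)}·((M−1)∕2)^{|T|}·((M+1)∕2)^{(d−1)−|T|} = 1` (binomial theorem, `(M−1)∕2 + (M+1)∕2 = M`; `M ≥ 1`). [folklore] -/
theorem sum_interpWeight {M : ℕ} (hM : 1 ≤ M) (κ : Fin d) :
    ∑ T ∈ (Finset.univ.erase κ).powerset,
        (((M : ℝ)) ^ (d - 1))⁻¹ * ((((M : ℝ)) - 1) / 2) ^ T.card * ((((M : ℝ)) + 1) / 2) ^ ((d - 1) - T.card) = 1 := by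
  have hM0 : (M : ℝ) ≠ 0 := by exact_mod_cast (by omega : M ≠ 0)
  have hScard : (Finset.univ.erase κ).card = d - 1 := by
    rw [Finset.card_erase_of_mem (Finset.mem_univ κ), Finset.card_univ, Fintype.card_fin]
  simp_rw [mul_assoc, ← Finset.mul_sum, ← hScard]
  rw [Finset.sum_pow_mul_eq_add_pow, show (((M : ℝ)) - 1) / 2 + (((M : ℝ)) + 1) / 2 = M by ring, hScard, inv_mul_cancel₀ (pow_ne_zero _ hM0)]

end

end Summit.QuantumFields.BalabanUV.T4Continuum.NE7InterpolationLiftFlat
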